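import Literature.Computability.Complexity.CookReducibilityTransitive
import Literature.Computability.Complexity.OracleEmpty
import HarnessLib

/-!
# `Δₖ₊₁ᵖ ⊆ Σₖ₊₁ᵖ ∩ Πₖ₊₁ᵖ` (Stockmeyer 1976, §3): the full inclusion (proof; trunk CplxCore)

`PRelHierarchy.lean` proves the two-level inclusion `P^{Σₖ} ⊆ Σₖ₊₂ ∩ Πₖ₊₂` without certificate
lists. With the toolkit of `CookReducibilityTransitive.lean` (clocked iteration, conditionals, transcript
codes) the printed one-level inclusion is now formalised:

* `Literature.Computability.Complexity.PRel_ofLanguage_subset_SigmaP_succ` — `A ∈ Σₖ₊₁ᵖ ⇒ P^A ⊆ Σₖ₊₂ᵖ`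
  (i.e. `P^{Σₖ₊₁} ⊆ Σₖ₊₂`, one level up);
* `Literature.Computability.Complexity.stockmeyer_DeltaP_succ_subset` — `Δₖ₊₁ᵖ ⊆ Σₖ₊₁ᵖ ∩ Πₖ₊₁ᵖ` for every `k`
  (for `k = 0` this is `Δ₁ = P`: `PRelClass_P_subset_P`, `DeltaP_one_eq_P`, from `P^∅ = P`
  of `OracleEmpty.lean` and `P^{P^O} = P^O` of `CookReducibilityTransitive.lean`).

## The printed argument and its formalisation

Stockmeyer (1976, Thm. 3.1, with §3 "`P(B) ⊆ NP(B) ∩ co-NP(B)`"): guess the oracle answers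
together with, for every positively answered query, a certificate of membership, and verify. For
`L ∈ P^A` (oracle algorithm `M`, budget `q`) and `A = {y | ∃ c, |c| ≤ p_A|y| ∧ ⟨y, c⟩ ∈ B}` with
`B ∈ Πₖ`, written `B = {w | ∀ c', |c'| ≤ p_B|w| → ⟨w, c'⟩ ∈ E}` with `E ∈ Σₖ`
(`exists_forall_rep_of_mem_PiP`):

  `x ∈ L ⇔ ∃ Y = ⟨as, body cs⟩ (|Y| ≤ p_Y|x|) ∀ z = ⟨tag, ⟨j, ⟨c, c'⟩⟩⟩ (|z| ≤ p'|⟨x, Y⟩|) : R`,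

where `as` are the guessed answer bits, `cs` the list of certificates (`cs_j` read off by the
polynomial-time list access `elemFn`, a clocked iteration of the second projection), and the
matrix `R ∈ Σₖ` distinguishes four cases by the tag: (ε) `|as| < q|x|` and the last step outputs
`1`; (`0`) round `|j|` is a query; (`10`) if round `|j|` is a query `y` answered `1` then
`|cs_j| ≤ p_A|y|` and (`|c'| ≤ p_B|⟨y, cs_j⟩|` ⇒ `⟨⟨y, cs_j⟩, c'⟩ ∈ E`); (`11`) if round `|j|` is a
query `y` answered `0` and `|c| ≤ p_A|y|` then `⟨y, c⟩ ∉ B`. Then `{X | ∀ z …} ∈ ∀ᵖ·Σₖ = Πₖ₊₁`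
and `L ∈ ∃ᵖ·Πₖ₊₁ = Σₖ₊₂`. Soundness is the round induction of `PRelHierarchy.lean`
(`mem_of_allLang`) with certificates; completeness chooses certificates for the `yes` rounds.

## References

* L. J. Stockmeyer, *The polynomial-time hierarchy*, Theoret. Comput. Sci. 3 (1976) 1–22, §3 and
  Thm. 3.1.
* S. Arora, B. Barak, *Computational Complexity: A Modern Approach*, CUP 2009, Def. 5.3,
  Thm. 5.12, §5.5.
-/

namespace Literature.Computability.Complexity

open _root_.Computability Polynomial PRelSigma OracleCompose

/-- **`P^P ⊆ P`**: a `P`-oracle is in `P^∅` (`P_subset_PRel_holds`), so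
`P^A ⊆ P^{P^∅} = P^∅ = P` (`mem_PRel_of_polyTimeTuringReducible_holds`, `PRel_empty_subset_P`).
[Baker–Gill–Solovay 1975, §1; Ladner–Lynch–Selman 1975, §2] [cite: BakerGillSolovay1975, §1] -/
theorem PRelClass_P_subset_P : PRelClass Classes.P ⊆ Classes.P := by
  intro L hL
  obtain ⟨A, hA, hLA⟩ := mem_PRelClass_iff.1 hL
  exact PRel_empty_subset_P (mem_PRel_of_polyTimeTuringReducible_holds hLA (P_subset_PRel_holds _ hA))

/-- **`Δ₁ᵖ = P`** (`Δ₁ = P^{Σ₀} = P^P`). [Stockmeyer 1976, §3] [cite: Stockmeyer1976, §3] -/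
theorem DeltaP_one_eq_P : DeltaP 1 = Classes.P := by
  refine Set.Subset.antisymm PRelClass_P_subset_P fun L hL => ?_
  exact mem_PRelClass_iff.2 ⟨L, hL, self_mem_PRel_ofLanguage_holds L⟩

/-- **`Πₖ` languages in `∀`-form**: `B ∈ Πₖᵖ` is `{w | ∀ c', |c'| ≤ p_B|w| → ⟨w, c'⟩ ∈ E}` for
some `E ∈ Σₖᵖ` (for `k = 0` the dummy quantifier with `E = {v | v.1 ∈ B}`; for `k + 1` the
definition `Πₖ₊₁ = ∀ᵖ·Σₖ` with `Σₖ ⊆ Σₖ₊₁`). [Arora–Barak 2009, Def. 5.3] [cite: Stockmeyer1976, §3] -/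
theorem exists_forall_rep_of_mem_PiP {k : ℕ} {B : Language Bool} (hB : B ∈ PiP k) :
    ∃ E : Language Bool, E ∈ SigmaP k ∧ ∃ pB : Polynomial ℕ, ∀ w : List Bool,
      w ∈ B ↔ ∀ c' : List Bool, c'.length ≤ pB.eval w.length → boolPair w c' ∈ E := by
  cases k with
  | zero =>
    have hBP : B ∈ Classes.P := compl_mem_P_iff.1 hB
    refine ⟨{v | (boolUnpair v).1 ∈ B}, P_closed_boolUnpair_fst B hBP, 0, fun w => ?_⟩
    constructor
    · intro hw c' _
      change (boolUnpair (boolPair w c')).1 ∈ B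
      rwa [boolUnpair_boolPair]
    · intro h
      have := h [] (by simp)
      change (boolUnpair (boolPair w [])).1 ∈ B at this
      rwa [boolUnpair_boolPair] at this
  | succ k =>
    obtain ⟨E, hE, pB, hpB⟩ := mem_polyForall_iff.1 hB
    exact ⟨E, SigmaP_subset_succ_holds k hE, pB, hpB⟩

namespace PRelSigPi

/-! ### Polynomial-time list access -/

/-- Iterated second projection: `nthRest ⟨j, bd⟩ = sndP^{|j|} bd`. [folklore] -/
noncomputable def nthRest (w : List Bool) : List Bool :=
  sndP^[(fstP w).length] (sndP w)

/-- **List access is in `FP`**: the clocked iteration of `sndP` (which never lengthens) after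
`optT ∘ rePair`. [Arora–Barak 2009, §1.4.1] [folklore] -/
theorem nthRest_mem_FP : nthRest ∈ FP := by
  have hit := PolyTimeComputable.iterate_of_le_add (α := List Bool) (A := Bool) (ea := id) (F := sndP) 0
    (fun a => by simpa [sndP] using length_boolUnpair_snd_le_length a) sndP_mem_FP
  have hin : PolyTimeComputable (id : List Bool → List Bool) (id : List (Option Bool) → List (Option Bool))
      (optT.eval ∘ rePair) :=
    PolyTimeComputable.comp_holds optT.polyTimeComputable_eval rePair_mem_FP
  have hg : PolyTimeComputable (id : List Bool → List Bool)
      (fun p : List Bool × ℕ => List.replicate p.2 none ++ (id p.1).map some)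
      (fun w => (sndP w, (fstP w).length)) := by
    obtain ⟨p, Mx, h⟩ := hin
    refine ⟨p, Mx, fun w => ?_⟩
    have hw := h w
    simp only [id, Function.comp_apply, rePair, optT_eval_boolPair] at hw ⊢
    exact hw
  obtain ⟨p, Mx, h⟩ := PolyTimeComputable.comp_holds hit hg
  exact ⟨p, Mx, fun w => h w⟩

/-- Iterated second projection of a body drops list elements. [folklore] -/
theorem iterate_sndP_body : ∀ (i : ℕ) (cs : List (List Bool)), sndP^[i] (body cs) = body (cs.drop i)
  | 0, _ => rfl
  | i + 1, [] => by
    rw [Function.iterate_succ_apply, show sndP (body []) = body [] from rfl, iterate_sndP_body i []]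
    simp
  | i + 1, a :: cs => by
    rw [Function.iterate_succ_apply, body_cons, sndP_boolPair]
    exact iterate_sndP_body i cs

/-- **The `j`-th certificate** read off `⟨j, body cs⟩`: `elemFn ⟨j, body cs⟩ = cs_{|j|}` (and `ε`
out of range). [folklore] -/
noncomputable def elemFn : List Bool → List Bool := fstP ∘ nthRest

/-- `elemFn ∈ FP`. [folklore] -/
theorem elemFn_mem_FP : elemFn ∈ FP := comp_mem_FP fstP_mem_FP nthRest_mem_FP

/-- Value of the list access on a body. [folklore] -/
theorem elemFn_boolPair_body (j : List Bool) (cs : List (List Bool)) :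
    elemFn (boolPair j (body cs)) = cs.getD j.length [] := by
  simp only [elemFn, nthRest, Function.comp_apply, fstP_boolPair, sndP_boolPair, iterate_sndP_body]
  cases h : cs.drop j.length with
  | nil =>
    rw [List.getD_eq_default _ _ (List.drop_eq_nil_iff.1 h)]
    rfl
  | cons a t =>
    have hlt : j.length < cs.length := by
      by_contra hge
      rw [List.drop_eq_nil_of_le (by omega)] at h
      cases h
    rw [body_cons, fstP_boolPair, List.getD_eq_getElem _ _ hlt]
    have := List.getElem_cons_drop hlt
    rw [h] at this
    exact ((List.cons.inj this).1).symm

/-- The `i`-th element read off an arbitrary string `csb` (as `elemFn` does). [folklore] -/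
def elemOf (csb : List Bool) (i : ℕ) : List Bool :=
  fstP (sndP^[i] csb)

/-- On a body, `elemOf` is list access. [folklore] -/
theorem elemOf_body (cs : List (List Bool)) (i : ℕ) : elemOf (body cs) i = cs.getD i [] := by
  have h := elemFn_boolPair_body (List.replicate i true) cs
  simp only [elemFn, nthRest, Function.comp_apply, fstP_boolPair, sndP_boolPair, List.length_replicate] at h
  exact h

/-- `elemFn ⟨j, csb⟩ = elemOf csb |j|`. [folklore] -/
theorem elemFn_boolPair (j csb : List Bool) : elemFn (boolPair j csb) = elemOf csb j.length := by
  simp [elemFn, nthRest, elemOf]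

/-! ### Accessors of `v = ⟨⟨x, Y⟩, ⟨tg, ⟨j, ⟨c, c'⟩⟩⟩⟩`, `Y` read as `⟨as, csb⟩` -/

/-- The guessed answer bits. [folklore] -/
def aFn : List Bool → List Bool := fstP ∘ sndP ∘ fstP
/-- The body of the certificate list. [folklore] -/
def csbFn : List Bool → List Bool := sndP ∘ sndP ∘ fstP
/-- The first certificate slot `c`. [folklore] -/
def c1Fn : List Bool → List Bool := fstP ∘ sndP ∘ sndP ∘ sndP
/-- The second certificate slot `c'`. [folklore] -/
def c2Fn : List Bool → List Bool := sndP ∘ sndP ∘ sndP ∘ sndP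

/-- `aFn ∈ FP`. [folklore] -/
theorem aFn_mem_FP : aFn ∈ FP := comp_mem_FP fstP_mem_FP (comp_mem_FP sndP_mem_FP fstP_mem_FP)
/-- `csbFn ∈ FP`. [folklore] -/
theorem csbFn_mem_FP : csbFn ∈ FP := comp_mem_FP sndP_mem_FP (comp_mem_FP sndP_mem_FP fstP_mem_FP)
/-- `c1Fn ∈ FP`. [folklore] -/
theorem c1Fn_mem_FP : c1Fn ∈ FP :=
  comp_mem_FP fstP_mem_FP (comp_mem_FP sndP_mem_FP (comp_mem_FP sndP_mem_FP sndP_mem_FP))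
/-- `c2Fn ∈ FP`. [folklore] -/
theorem c2Fn_mem_FP : c2Fn ∈ FP :=
  comp_mem_FP sndP_mem_FP (comp_mem_FP sndP_mem_FP (comp_mem_FP sndP_mem_FP sndP_mem_FP))

section AccessorValues

variable (x Y z : List Bool)

/-- Reading `x`. [folklore] -/
@[simp] theorem xFn_apply' : xFn (boolPair (boolPair x Y) z) = x := by simp [xFn]
/-- Reading `as`. [folklore] -/
@[simp] theorem aFn_apply : aFn (boolPair (boolPair x Y) z) = (boolUnpair Y).1 := by simp [aFn, fstP, sndP]
/-- Reading `csb`. [folklore] -/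
@[simp] theorem csbFn_apply : csbFn (boolPair (boolPair x Y) z) = (boolUnpair Y).2 := by simp [csbFn, fstP, sndP]
/-- Reading `c`. [folklore] -/
@[simp] theorem c1Fn_apply : c1Fn (boolPair (boolPair x Y) z) =
    (boolUnpair (boolUnpair (boolUnpair z).2).2).1 := by simp [c1Fn, fstP, sndP]
/-- Reading `c'`. [folklore] -/
@[simp] theorem c2Fn_apply : c2Fn (boolPair (boolPair x Y) z) =
    (boolUnpair (boolUnpair (boolUnpair z).2).2).2 := by simp [c2Fn, sndP]
/-- Reading the tag. [folklore] -/
@[simp] theorem tgFn_apply' : tgFn (boolPair (boolPair x Y) z) = (boolUnpair z).1 := by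
  simp [tgFn, fstP, sndP]
/-- Reading `j`. [folklore] -/
@[simp] theorem jFn_apply' : jFn (boolPair (boolPair x Y) z) = (boolUnpair (boolUnpair z).2).1 := by
  simp [jFn, fstP, sndP]

end AccessorValues

/-- The guessed-answer prefix `as ↾ |j|`. [folklore] -/
noncomputable def preA : List Bool → List Bool := sndP ∘ truncSndFn X ∘ pairFn jFn aFn
/-- The guessed-answer suffix `as.drop |j|`. [folklore] -/
noncomputable def sufA : List Bool → List Bool := sndP ∘ dropSndFn X ∘ pairFn jFn aFn
/-- The `j`-th certificate. [folklore] -/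
noncomputable def csjFn : List Bool → List Bool := elemFn ∘ pairFn jFn csbFn

/-- `preA ∈ FP`. [folklore] -/
theorem preA_mem_FP : preA ∈ FP :=
  comp_mem_FP sndP_mem_FP (comp_mem_FP (truncSndFn_mem_FP X) (pairFn_mem_FP jFn_mem_FP aFn_mem_FP))
/-- `sufA ∈ FP`. [folklore] -/
theorem sufA_mem_FP : sufA ∈ FP :=
  comp_mem_FP sndP_mem_FP (comp_mem_FP (dropSndFn_mem_FP X) (pairFn_mem_FP jFn_mem_FP aFn_mem_FP))
/-- `csjFn ∈ FP`. [folklore] -/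
theorem csjFn_mem_FP : csjFn ∈ FP := comp_mem_FP elemFn_mem_FP (pairFn_mem_FP jFn_mem_FP csbFn_mem_FP)

section MoreValues

variable (x Y z : List Bool)

/-- Reading the prefix. [folklore] -/
@[simp] theorem preA_apply :
    preA (boolPair (boolPair x Y) z) = (boolUnpair Y).1.take (boolUnpair (boolUnpair z).2).1.length := by
  simp [preA, truncSndFn_boolPair]
/-- Reading the suffix. [folklore] -/
@[simp] theorem sufA_apply :
    sufA (boolPair (boolPair x Y) z) = (boolUnpair Y).1.drop (boolUnpair (boolUnpair z).2).1.length := by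
  simp [sufA, dropSndFn_boolPair]
/-- Reading the `j`-th certificate. [folklore] -/
@[simp] theorem csjFn_apply :
    csjFn (boolPair (boolPair x Y) z) = elemOf (boolUnpair Y).2 (boolUnpair (boolUnpair z).2).1.length := by
  simp [csjFn, elemFn_boolPair]

end MoreValues

/-! ### The step machine pieces -/

variable (M : OracleAlg Bool)

/-- The code of the step of `M` at round `|j|` along the guessed answers. [folklore] -/
noncomputable def stFn (v : List Bool) : List Bool :=
  stepCode (M.step (xFn v) (bitsTrans (preA v)))
/-- The code of the step of `M` after all guessed answers. [folklore] -/
noncomputable def ltFn (v : List Bool) : List Bool :=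
  stepCode (M.step (xFn v) (bitsTrans (aFn v)))

/-- `stFn ∈ FP`. [folklore] -/
theorem stFn_mem_FP (hM : M.IsPolyTime encodingBoolBool) : stFn M ∈ FP :=
  stepCode_comp_mem_FP M hM xFn_mem_FP preA_mem_FP
/-- `ltFn ∈ FP`. [folklore] -/
theorem ltFn_mem_FP (hM : M.IsPolyTime encodingBoolBool) : ltFn M ∈ FP :=
  stepCode_comp_mem_FP M hM xFn_mem_FP aFn_mem_FP

/-- Reading `stFn`. [folklore] -/
theorem stFn_apply (x Y z : List Bool) :
    stFn M (boolPair (boolPair x Y) z) =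
      stepCode (M.step x (bitsTrans ((boolUnpair Y).1.take (boolUnpair (boolUnpair z).2).1.length))) := by
  simp [stFn]
/-- Reading `ltFn`. [folklore] -/
theorem ltFn_apply (x Y z : List Bool) :
    ltFn M (boolPair (boolPair x Y) z) = stepCode (M.step x (bitsTrans (boolUnpair Y).1)) := by
  simp [ltFn]

/-! ### The matrix -/

section Matrix

variable (A B E : Language Bool) (pA pB q : Polynomial ℕ)

/-- Guard of the final case: `|as| < q|x|`. [folklore] -/
noncomputable def KA : Language Bool := pairFn xFn aFn ⁻¹' LenLt q
/-- The last step outputs `1`. [folklore] -/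
noncomputable def KF : Language Bool := (ltFn M ⁻¹' HeadIs true) ⊓ ((List.tail ∘ ltFn M) ⁻¹' HeadIs true)
/-- `|j| < |as|`. [folklore] -/
noncomputable def KJ : Language Bool := pairFn aFn jFn ⁻¹' LenLt X
/-- Round `|j|` is a query. [folklore] -/
noncomputable def KQ : Language Bool := stFn M ⁻¹' HeadIs false
/-- The guessed answer of round `|j|` is `1`. [folklore] -/
noncomputable def KT : Language Bool := sufA ⁻¹' HeadIs true
/-- The guessed answer of round `|j|` is `0`. [folklore] -/
noncomputable def KFa : Language Bool := sufA ⁻¹' HeadIs false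
/-- `|cs_j| ≤ p_A |y|`. [folklore] -/
noncomputable def KLA : Language Bool := pairFn (List.tail ∘ stFn M) csjFn ⁻¹' LenLe pA
/-- `|c'| ≤ p_B |⟨y, cs_j⟩|`. [folklore] -/
noncomputable def KLB : Language Bool := pairFn (pairFn (List.tail ∘ stFn M) csjFn) c2Fn ⁻¹' LenLe pB
/-- `⟨⟨y, cs_j⟩, c'⟩ ∈ E`. [folklore] -/
noncomputable def KE : Language Bool := pairFn (pairFn (List.tail ∘ stFn M) csjFn) c2Fn ⁻¹' E
/-- `|c| ≤ p_A |y|`. [folklore] -/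
noncomputable def KLC : Language Bool := pairFn (List.tail ∘ stFn M) c1Fn ⁻¹' LenLe pA
/-- `⟨y, c⟩ ∉ B`. [folklore] -/
noncomputable def KNB : Language Bool := pairFn (List.tail ∘ stFn M) c1Fn ⁻¹' Bᶜ
/-- Tag `ε`. [folklore] -/
def UA : Language Bool := tgFn ⁻¹' IsNil
/-- Tag `0…`. [folklore] -/
def UB : Language Bool := tgFn ⁻¹' HeadIs false
/-- Tag `10…` (given not `ε`, not `0…`). [folklore] -/
def UC : Language Bool := (List.tail ∘ tgFn) ⁻¹' HeadIs false

/-- Case `ε`. [folklore] -/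
noncomputable def kaseA : Language Bool := KA q ⊓ KF M
/-- Case `0…`. [folklore] -/
noncomputable def kaseB : Language Bool := (KJ)ᶜ ⊔ KQ M
/-- Case `10…`. [folklore] -/
noncomputable def kaseC : Language Bool := (KJ ⊓ KQ M ⊓ KT)ᶜ ⊔ (KLA M pA ⊓ ((KLB M pB)ᶜ ⊔ KE M E))
/-- Case `11…`. [folklore] -/
noncomputable def kaseD : Language Bool := (KJ ⊓ KQ M ⊓ KFa ⊓ KLC M pA)ᶜ ⊔ KNB M B

/-- **The matrix** of the `∃∀`-form. [Stockmeyer 1976, proof of Thm. 3.1] [cite: Stockmeyer1976, Thm. 3.1 (proof)] -/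
noncomputable def matrixL : Language Bool :=
  caseSplit UA (kaseA M q) (caseSplit UB (kaseB M) (caseSplit UC (kaseC M E pA pB) (kaseD M B pA)))

/-- **The matrix is a `Σₖᵖ` language** for `E, Bᶜ ∈ Σₖᵖ` and polynomial-time `M`.
[Stockmeyer 1976, proof of Thm. 3.1] [cite: Stockmeyer1976, Thm. 3.1 (proof)] -/
theorem matrixL_mem_SigmaP {k : ℕ} (hM : M.IsPolyTime encodingBoolBool) (hE : E ∈ SigmaP k)
    (hB : Bᶜ ∈ SigmaP k) : matrixL M B E pA pB q ∈ SigmaP k := by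
  obtain ⟨hpre, hinter, hunion⟩ := SigmaP_closure k
  have hP : ∀ {L : Language Bool}, L ∈ Classes.P → L ∈ SigmaP k := fun h => P_subset_SigmaP k h
  have hqry : (List.tail ∘ stFn M) ∈ FP := comp_mem_FP tail_mem_FP (stFn_mem_FP M hM)
  have hKA : KA q ∈ Classes.P := preimage_mem_P (LenLt_mem_P q) (pairFn_mem_FP xFn_mem_FP aFn_mem_FP)
  have hKF : KF M ∈ Classes.P :=
    inter_mem_P (preimage_mem_P (HeadIs_mem_P true) (ltFn_mem_FP M hM))
      (preimage_mem_P (HeadIs_mem_P true) (comp_mem_FP tail_mem_FP (ltFn_mem_FP M hM)))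
  have hKJ : KJ ∈ Classes.P := preimage_mem_P (LenLt_mem_P X) (pairFn_mem_FP aFn_mem_FP jFn_mem_FP)
  have hKQ : KQ M ∈ Classes.P := preimage_mem_P (HeadIs_mem_P false) (stFn_mem_FP M hM)
  have hKT : KT ∈ Classes.P := preimage_mem_P (HeadIs_mem_P true) sufA_mem_FP
  have hKFa : KFa ∈ Classes.P := preimage_mem_P (HeadIs_mem_P false) sufA_mem_FP
  have hKLA : KLA M pA ∈ Classes.P := preimage_mem_P (LenLe_mem_P pA) (pairFn_mem_FP hqry csjFn_mem_FP)
  have hKLB : KLB M pB ∈ Classes.P :=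
    preimage_mem_P (LenLe_mem_P pB) (pairFn_mem_FP (pairFn_mem_FP hqry csjFn_mem_FP) c2Fn_mem_FP)
  have hKE : KE M E ∈ SigmaP k := hpre hE (pairFn_mem_FP (pairFn_mem_FP hqry csjFn_mem_FP) c2Fn_mem_FP)
  have hKLC : KLC M pA ∈ Classes.P := preimage_mem_P (LenLe_mem_P pA) (pairFn_mem_FP hqry c1Fn_mem_FP)
  have hKNB : KNB M B ∈ SigmaP k := hpre hB (pairFn_mem_FP hqry c1Fn_mem_FP)
  have hUA : UA ∈ Classes.P := preimage_mem_P IsNil_mem_P tgFn_mem_FP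
  have hUB : UB ∈ Classes.P := preimage_mem_P (HeadIs_mem_P false) tgFn_mem_FP
  have hUC : UC ∈ Classes.P := preimage_mem_P (HeadIs_mem_P false) (comp_mem_FP tail_mem_FP tgFn_mem_FP)
  have hA' : kaseA M q ∈ SigmaP k := hP (inter_mem_P hKA hKF)
  have hB' : kaseB M ∈ SigmaP k := hP (union_mem_P (compl_mem_P_iff.2 hKJ) hKQ)
  have hC' : kaseC M E pA pB ∈ SigmaP k :=
    hunion (compl_mem_P_iff.2 (inter_mem_P (inter_mem_P hKJ hKQ) hKT))
      (hinter hKLA (hunion (compl_mem_P_iff.2 hKLB) hKE))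
  have hD' : kaseD M B pA ∈ SigmaP k :=
    hunion (compl_mem_P_iff.2 (inter_mem_P (inter_mem_P (inter_mem_P hKJ hKQ) hKFa) hKLC)) hKNB
  exact caseSplit_mem_SigmaP k hUA hA' (caseSplit_mem_SigmaP k hUB hB' (caseSplit_mem_SigmaP k hUC hC' hD'))

/-! #### Reading the matrix -/

/-- Condition of case `ε`. [folklore] -/
def CndA (x as : List Bool) : Prop :=
  as.length < q.eval x.length ∧ M.step x (bitsTrans as) = Sum.inr true

/-- Condition of case `0…` at round `j`. [folklore] -/
def CndB (x as : List Bool) (j : ℕ) : Prop :=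
  j < as.length → ∃ y, M.step x (bitsTrans (as.take j)) = Sum.inl y

/-- Condition of case `10…` at round `j`: certificate `cj`, second slot `c'`. [folklore] -/
def CndC (x as : List Bool) (j : ℕ) (cj c' : List Bool) : Prop :=
  ∀ y, M.step x (bitsTrans (as.take j)) = Sum.inl y → j < as.length → (as.drop j).head? = some true →
    cj.length ≤ pA.eval y.length ∧
      (c'.length ≤ pB.eval (boolPair y cj).length → boolPair (boolPair y cj) c' ∈ E)

/-- Condition of case `11…` at round `j`, first slot `c`. [folklore] -/
def CndD (x as : List Bool) (j : ℕ) (c : List Bool) : Prop :=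
  ∀ y, M.step x (bitsTrans (as.take j)) = Sum.inl y → j < as.length → (as.drop j).head? = some false →
    c.length ≤ pA.eval y.length → boolPair y c ∉ B

variable (x Y z : List Bool)


/-- Reading `KA`. [folklore] -/
theorem mem_KA_iff : (boolPair (boolPair x Y) z) ∈ KA q ↔ (boolUnpair Y).1.length < q.eval x.length := by
  change pairFn xFn aFn (boolPair (boolPair x Y) z) ∈ LenLt q ↔ _
  simp only [pairFn_apply, xFn_apply', aFn_apply, boolPair_mem_LenLt]

/-- Reading `KF`. [folklore] -/
theorem mem_KF_iff : (boolPair (boolPair x Y) z) ∈ KF M ↔ M.step x (bitsTrans (boolUnpair Y).1) = Sum.inr true := by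
  change ltFn M (boolPair (boolPair x Y) z) ∈ HeadIs true ∧ (ltFn M (boolPair (boolPair x Y) z)).tail ∈ HeadIs true ↔ _
  rw [ltFn_apply, stepCode_output_true_iff]

/-- Reading `KJ`. [folklore] -/
theorem mem_KJ_iff : (boolPair (boolPair x Y) z) ∈ KJ ↔ (boolUnpair (boolUnpair z).2).1.length < (boolUnpair Y).1.length := by
  change pairFn aFn jFn (boolPair (boolPair x Y) z) ∈ LenLt X ↔ _
  simp only [pairFn_apply, aFn_apply, jFn_apply', boolPair_mem_LenLt, eval_X]

/-- Reading `KQ`. [folklore] -/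
theorem mem_KQ_iff : (boolPair (boolPair x Y) z) ∈ KQ M ↔ ∃ y, M.step x (bitsTrans ((boolUnpair Y).1.take (boolUnpair (boolUnpair z).2).1.length)) = Sum.inl y := by
  change stFn M (boolPair (boolPair x Y) z) ∈ HeadIs false ↔ _
  rw [stFn_apply, stepCode_mem_HeadIs_false_iff]

/-- Reading `KT`. [folklore] -/
theorem mem_KT_iff : (boolPair (boolPair x Y) z) ∈ KT ↔ ((boolUnpair Y).1.drop (boolUnpair (boolUnpair z).2).1.length).head? = some true := by
  change sufA (boolPair (boolPair x Y) z) ∈ HeadIs true ↔ _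
  rw [sufA_apply, mem_HeadIs]

/-- Reading `KFa`. [folklore] -/
theorem mem_KFa_iff : (boolPair (boolPair x Y) z) ∈ KFa ↔ ((boolUnpair Y).1.drop (boolUnpair (boolUnpair z).2).1.length).head? = some false := by
  change sufA (boolPair (boolPair x Y) z) ∈ HeadIs false ↔ _
  rw [sufA_apply, mem_HeadIs]

/-- Reading `KLA`. [folklore] -/
theorem mem_KLA_iff : (boolPair (boolPair x Y) z) ∈ KLA M pA ↔
    ((elemOf (boolUnpair Y).2 (boolUnpair (boolUnpair z).2).1.length)).length ≤ pA.eval (stepCode (M.step x (bitsTrans ((boolUnpair Y).1.take (boolUnpair (boolUnpair z).2).1.length)))).tail.length := by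
  change pairFn (List.tail ∘ stFn M) csjFn (boolPair (boolPair x Y) z) ∈ LenLe pA ↔ _
  rw [pairFn_apply, Function.comp_apply, stFn_apply, csjFn_apply, boolPair_mem_LenLe]

/-- Reading `KLB`. [folklore] -/
theorem mem_KLB_iff : (boolPair (boolPair x Y) z) ∈ KLB M pB ↔
    ((boolUnpair (boolUnpair (boolUnpair z).2).2).2).length ≤ pB.eval (boolPair (stepCode (M.step x (bitsTrans ((boolUnpair Y).1.take (boolUnpair (boolUnpair z).2).1.length)))).tail ((elemOf (boolUnpair Y).2 (boolUnpair (boolUnpair z).2).1.length))).length := by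
  change pairFn (pairFn (List.tail ∘ stFn M) csjFn) c2Fn (boolPair (boolPair x Y) z) ∈ LenLe pB ↔ _
  rw [pairFn_apply, pairFn_apply, Function.comp_apply, stFn_apply, csjFn_apply, c2Fn_apply, boolPair_mem_LenLe]

/-- Reading `KE`. [folklore] -/
theorem mem_KE_iff : (boolPair (boolPair x Y) z) ∈ KE M E ↔
    boolPair (boolPair (stepCode (M.step x (bitsTrans ((boolUnpair Y).1.take (boolUnpair (boolUnpair z).2).1.length)))).tail ((elemOf (boolUnpair Y).2 (boolUnpair (boolUnpair z).2).1.length))) (boolUnpair (boolUnpair (boolUnpair z).2).2).2 ∈ E := by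
  change pairFn (pairFn (List.tail ∘ stFn M) csjFn) c2Fn (boolPair (boolPair x Y) z) ∈ E ↔ _
  rw [pairFn_apply, pairFn_apply, Function.comp_apply, stFn_apply, csjFn_apply, c2Fn_apply]

/-- Reading `KLC`. [folklore] -/
theorem mem_KLC_iff : (boolPair (boolPair x Y) z) ∈ KLC M pA ↔
    ((boolUnpair (boolUnpair (boolUnpair z).2).2).1).length ≤ pA.eval (stepCode (M.step x (bitsTrans ((boolUnpair Y).1.take (boolUnpair (boolUnpair z).2).1.length)))).tail.length := by
  change pairFn (List.tail ∘ stFn M) c1Fn (boolPair (boolPair x Y) z) ∈ LenLe pA ↔ _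
  rw [pairFn_apply, Function.comp_apply, stFn_apply, c1Fn_apply, boolPair_mem_LenLe]

/-- Reading `KNB`. [folklore] -/
theorem mem_KNB_iff : (boolPair (boolPair x Y) z) ∈ KNB M B ↔
    boolPair (stepCode (M.step x (bitsTrans ((boolUnpair Y).1.take (boolUnpair (boolUnpair z).2).1.length)))).tail (boolUnpair (boolUnpair (boolUnpair z).2).2).1 ∉ B := by
  change pairFn (List.tail ∘ stFn M) c1Fn (boolPair (boolPair x Y) z) ∈ Bᶜ ↔ _
  rw [pairFn_apply, Function.comp_apply, stFn_apply, c1Fn_apply]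
  rfl

/-- Reading `UA`. [folklore] -/
theorem mem_UA_iff : (boolPair (boolPair x Y) z) ∈ UA ↔ (boolUnpair z).1 = [] := by
  change tgFn (boolPair (boolPair x Y) z) ∈ IsNil ↔ _
  rw [tgFn_apply', mem_IsNil]

/-- Reading `UB`. [folklore] -/
theorem mem_UB_iff : (boolPair (boolPair x Y) z) ∈ UB ↔ (boolUnpair z).1.head? = some false := by
  change tgFn (boolPair (boolPair x Y) z) ∈ HeadIs false ↔ _
  rw [tgFn_apply', mem_HeadIs]

/-- Reading `UC`. [folklore] -/
theorem mem_UC_iff : (boolPair (boolPair x Y) z) ∈ UC ↔ (boolUnpair z).1.tail.head? = some false := by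
  change (tgFn (boolPair (boolPair x Y) z)).tail ∈ HeadIs false ↔ _
  rw [tgFn_apply', mem_HeadIs]

/-- Reading case `ε`. [folklore] -/
theorem mem_kaseA_iff : (boolPair (boolPair x Y) z) ∈ kaseA M q ↔ CndA M q x (boolUnpair Y).1 := by
  change (boolPair (boolPair x Y) z) ∈ KA q ∧ (boolPair (boolPair x Y) z) ∈ KF M ↔ _
  rw [mem_KA_iff, mem_KF_iff]
  rfl

/-- Reading case `0…`. [folklore] -/
theorem mem_kaseB_iff : (boolPair (boolPair x Y) z) ∈ kaseB M ↔ CndB M x (boolUnpair Y).1 (boolUnpair (boolUnpair z).2).1.length := by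
  change ¬ (boolPair (boolPair x Y) z) ∈ KJ ∨ (boolPair (boolPair x Y) z) ∈ KQ M ↔ _
  rw [mem_KJ_iff, mem_KQ_iff]
  unfold CndB
  tauto

/-- Reading case `10…`. [folklore] -/
theorem mem_kaseC_iff : (boolPair (boolPair x Y) z) ∈ kaseC M E pA pB ↔ CndC M E pA pB x (boolUnpair Y).1 (boolUnpair (boolUnpair z).2).1.length ((elemOf (boolUnpair Y).2 (boolUnpair (boolUnpair z).2).1.length)) (boolUnpair (boolUnpair (boolUnpair z).2).2).2 := by
  change ¬ (((boolPair (boolPair x Y) z) ∈ KJ ∧ (boolPair (boolPair x Y) z) ∈ KQ M) ∧ (boolPair (boolPair x Y) z) ∈ KT) ∨ ((boolPair (boolPair x Y) z) ∈ KLA M pA ∧ (¬ (boolPair (boolPair x Y) z) ∈ KLB M pB ∨ (boolPair (boolPair x Y) z) ∈ KE M E)) ↔ _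
  rw [mem_KJ_iff, mem_KQ_iff, mem_KT_iff, mem_KLA_iff, mem_KLB_iff, mem_KE_iff]
  unfold CndC
  constructor
  · rintro h y hy hj hb
    rw [hy, tail_stepCode_inl] at h
    rcases h with h | ⟨hl, h⟩
    · exact absurd ⟨⟨hj, y, rfl⟩, hb⟩ h
    · exact ⟨hl, fun hc => h.resolve_left (fun hn => hn hc)⟩
  · intro h
    by_cases hall : ((boolUnpair (boolUnpair z).2).1.length < (boolUnpair Y).1.length ∧ ∃ y, M.step x (bitsTrans ((boolUnpair Y).1.take (boolUnpair (boolUnpair z).2).1.length)) = Sum.inl y) ∧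
        ((boolUnpair Y).1.drop (boolUnpair (boolUnpair z).2).1.length).head? = some true
    · obtain ⟨⟨hj, y, hy⟩, hb⟩ := hall
      obtain ⟨hl, himp⟩ := h y hy hj hb
      right
      rw [hy, tail_stepCode_inl]
      refine ⟨hl, ?_⟩
      by_cases hc : ((boolUnpair (boolUnpair (boolUnpair z).2).2).2).length ≤ pB.eval (boolPair y ((elemOf (boolUnpair Y).2 (boolUnpair (boolUnpair z).2).1.length))).length
      · exact Or.inr (himp hc)
      · exact Or.inl hc
    · exact Or.inl hall

/-- Reading case `11…`. [folklore] -/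
theorem mem_kaseD_iff : (boolPair (boolPair x Y) z) ∈ kaseD M B pA ↔ CndD M B pA x (boolUnpair Y).1 (boolUnpair (boolUnpair z).2).1.length (boolUnpair (boolUnpair (boolUnpair z).2).2).1 := by
  change ¬ ((((boolPair (boolPair x Y) z) ∈ KJ ∧ (boolPair (boolPair x Y) z) ∈ KQ M) ∧ (boolPair (boolPair x Y) z) ∈ KFa) ∧ (boolPair (boolPair x Y) z) ∈ KLC M pA) ∨ (boolPair (boolPair x Y) z) ∈ KNB M B ↔ _
  rw [mem_KJ_iff, mem_KQ_iff, mem_KFa_iff, mem_KLC_iff, mem_KNB_iff]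
  unfold CndD
  constructor
  · rintro h y hy hj hb hc
    rw [hy, tail_stepCode_inl] at h
    rcases h with h | h
    · exact absurd ⟨⟨⟨hj, y, rfl⟩, hb⟩, hc⟩ h
    · exact h
  · intro h
    by_cases hall : (((boolUnpair (boolUnpair z).2).1.length < (boolUnpair Y).1.length ∧ ∃ y, M.step x (bitsTrans ((boolUnpair Y).1.take (boolUnpair (boolUnpair z).2).1.length)) = Sum.inl y) ∧
        ((boolUnpair Y).1.drop (boolUnpair (boolUnpair z).2).1.length).head? = some false) ∧
        ((boolUnpair (boolUnpair (boolUnpair z).2).2).1).length ≤ pA.eval (stepCode (M.step x (bitsTrans ((boolUnpair Y).1.take (boolUnpair (boolUnpair z).2).1.length)))).tail.length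
    · obtain ⟨⟨⟨hj, y, hy⟩, hb⟩, hc⟩ := hall
      right
      rw [hy, tail_stepCode_inl] at hc ⊢
      exact h y hy hj hb hc
    · exact Or.inl hall

/-- **Reading the matrix.** [Stockmeyer 1976, proof of Thm. 3.1] [cite: Stockmeyer1976, Thm. 3.1 (proof)] -/
theorem mem_matrixL_iff : (boolPair (boolPair x Y) z) ∈ matrixL M B E pA pB q ↔
    ((boolUnpair z).1 = [] → CndA M q x (boolUnpair Y).1) ∧
    ((boolUnpair z).1 ≠ [] →
      ((boolUnpair z).1.head? = some false → CndB M x (boolUnpair Y).1 (boolUnpair (boolUnpair z).2).1.length) ∧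
      ((boolUnpair z).1.head? ≠ some false →
        ((boolUnpair z).1.tail.head? = some false → CndC M E pA pB x (boolUnpair Y).1 (boolUnpair (boolUnpair z).2).1.length ((elemOf (boolUnpair Y).2 (boolUnpair (boolUnpair z).2).1.length)) (boolUnpair (boolUnpair (boolUnpair z).2).2).2) ∧
        ((boolUnpair z).1.tail.head? ≠ some false → CndD M B pA x (boolUnpair Y).1 (boolUnpair (boolUnpair z).2).1.length (boolUnpair (boolUnpair (boolUnpair z).2).2).1))) := by
  unfold matrixL
  rw [mem_caseSplit_iff, mem_caseSplit_iff, mem_caseSplit_iff, mem_UA_iff, mem_UB_iff, mem_UC_iff,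
    mem_kaseA_iff, mem_kaseB_iff, mem_kaseC_iff, mem_kaseD_iff]

end Matrix

/-! ### Correctness -/

section Correctness

variable (M : OracleAlg Bool) (A B E : Language Bool) (pA pB q : Polynomial ℕ)

/-- The `Πₖ₊₁` language `{X | ∀ z, |z| ≤ p'|X| → ⟨X, z⟩ ∈ R}`. [Stockmeyer 1976, Thm. 3.1] [cite: Stockmeyer1976, Thm. 3.1 (proof)] -/
noncomputable def allL (p' : Polynomial ℕ) : Language Bool :=
  {X | ∀ z : List Bool, z.length ≤ p'.eval X.length → boolPair X z ∈ matrixL M B E pA pB q}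

/-- `allL ∈ ∀ᵖ·K` as soon as the matrix is in `K`. [Arora–Barak 2009, Def. 5.3] [folklore] -/
theorem allL_mem_polyForall {K : Set (Language Bool)} (hR : matrixL M B E pA pB q ∈ K) (p' : Polynomial ℕ) :
    allL M B E pA pB q p' ∈ polyForall K :=
  mem_polyForall_iff.2 ⟨matrixL M B E pA pB q, hR, p', fun _ => Iff.rfl⟩

/-- The bound on `z`: `14 + 2q + 2 p_A∘q + p_B∘(2q + 2 + p_A∘q)`. [folklore] -/
noncomputable def zBd : Polynomial ℕ :=
  C 14 + C 2 * q + C 2 * pA.comp q + pB.comp (C 2 * q + C 2 + pA.comp q)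

/-- Evaluation of the bound on `z`. [folklore] -/
theorem zBd_eval (n : ℕ) : (zBd pA pB q).eval n =
    14 + 2 * q.eval n + 2 * pA.eval (q.eval n) + pB.eval (2 * q.eval n + 2 + pA.eval (q.eval n)) := by
  simp [zBd, eval_comp]

/-- The bound on the certificate `Y`: `2q + 2 + q (2 p_A∘q + 2)`. [folklore] -/
noncomputable def yBd : Polynomial ℕ :=
  C 2 * q + C 2 + q * (C 2 * pA.comp q + C 2)

/-- Evaluation of the bound on `Y`. [folklore] -/
theorem yBd_eval (n : ℕ) : (yBd pA q).eval n = 2 * q.eval n + 2 + q.eval n * (2 * pA.eval (q.eval n) + 2) := by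
  simp [yBd, eval_comp]

/-- The instance of case `ε`. [folklore] -/
def wA : List Bool := boolPair [] []
/-- The instance of case `0…` at round `i`. [folklore] -/
def wB (i : ℕ) : List Bool := boolPair [false] (boolPair (List.replicate i true) [])
/-- The instance of case `10…` at round `i` with second slot `c'`. [folklore] -/
def wC (i : ℕ) (c' : List Bool) : List Bool :=
  boolPair [true, false] (boolPair (List.replicate i true) (boolPair [] c'))
/-- The instance of case `11…` at round `i` with first slot `c`. [folklore] -/
def wD (i : ℕ) (c : List Bool) : List Bool :=
  boolPair [true, true] (boolPair (List.replicate i true) (boolPair c []))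

/-- Length of the case-`ε` instance. [folklore] -/
@[simp] theorem length_wA : wA.length = 2 := by simp [wA]
/-- Length of the case-`0` instance. [folklore] -/
@[simp] theorem length_wB (i : ℕ) : (wB i).length = 2 * i + 6 := by simp [wB]; omega
/-- Length of the case-`10` instance. [folklore] -/
@[simp] theorem length_wC (i : ℕ) (c' : List Bool) : (wC i c').length = 2 * i + 10 + c'.length := by
  simp [wC]; omega
/-- Length of the case-`11` instance. [folklore] -/
@[simp] theorem length_wD (i : ℕ) (c : List Bool) : (wD i c).length = 2 * i + 10 + 2 * c.length := by
  simp [wD]; omega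

/-- The length of a body: `Σ (2|cⱼ| + 2)`, bounded when the elements are. [folklore] -/
theorem length_body_le {cs : List (List Bool)} {b : ℕ} (h : ∀ c ∈ cs, c.length ≤ b) :
    (body cs).length ≤ cs.length * (2 * b + 2) := by
  induction cs with
  | nil => simp
  | cons a cs ih =>
    rw [body_cons, length_boolPair, List.length_cons, add_mul, one_mul]
    have ha := h a (by simp)
    have := ih (fun c hc => h c (by simp [hc]))
    omega

variable {M A B E pA pB q}

/-- **Soundness of the `∃∀`-form** (with certificates): for an arbitrary certificate string `Y`,
read as `⟨as, csb⟩`. [Stockmeyer 1976, proof of Thm. 3.1] [cite: Stockmeyer1976, Thm. 3.1 (proof)] -/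
theorem mem_of_allL
    (hpA : ∀ y : List Bool, y ∈ A ↔ ∃ c : List Bool, c.length ≤ pA.eval y.length ∧ boolPair y c ∈ B)
    (hpB : ∀ w : List Bool, w ∈ B ↔ ∀ c' : List Bool, c'.length ≤ pB.eval w.length → boolPair w c' ∈ E)
    {L : Language Bool}
    (hq : ∀ x : List Bool, M.run (Oracle.ofLanguage A) (q.eval x.length) x = some (L.boolIndicator x) ∧
      ∀ y ∈ M.queries (Oracle.ofLanguage A) (q.eval x.length) x, y.length ≤ q.eval x.length)
    {x Y : List Bool}
    (hall : ∀ z : List Bool, z.length ≤ (zBd pA pB q).eval (boolPair x Y).length →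
      boolPair (boolPair x Y) z ∈ matrixL M B E pA pB q) : x ∈ L := by
  set O := Oracle.ofLanguage A with hO
  set as := (boolUnpair Y).1 with has
  set csb := (boolUnpair Y).2 with hcsb
  have hxw : x.length ≤ (boolPair x Y).length := by rw [length_boolPair]; omega
  have hqw : q.eval x.length ≤ q.eval (boolPair x Y).length := TM2Iter.eval_mono q hxw
  have hpAq : pA.eval (q.eval x.length) ≤ pA.eval (q.eval (boolPair x Y).length) := TM2Iter.eval_mono pA hqw
  have hbound : ∀ (i : ℕ) (c c' : List Bool), i ≤ q.eval x.length → c.length ≤ pA.eval (q.eval x.length) →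
      c'.length ≤ pB.eval (2 * q.eval x.length + 2 + pA.eval (q.eval x.length)) →
      2 * i + 10 + 2 * c.length + c'.length ≤ (zBd pA pB q).eval (boolPair x Y).length := by
    intro i c c' hi hc hc'
    rw [zBd_eval]
    have : pB.eval (2 * q.eval x.length + 2 + pA.eval (q.eval x.length)) ≤
        pB.eval (2 * q.eval (boolPair x Y).length + 2 + pA.eval (q.eval (boolPair x Y).length)) :=
      TM2Iter.eval_mono pB (by omega)
    omega
  -- case ε
  have hA : CndA M q x as := by
    have h := hall wA (by
      have := hbound 0 [] [] (Nat.zero_le _) (by simp) (by simp)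
      simp only [List.length_nil, length_wA] at this ⊢
      omega)
    rw [mem_matrixL_iff] at h
    exact h.1 (by simp [wA])
  have has_lt : as.length < q.eval x.length := hA.1
  -- validity of the guessed answers, by strong induction over the rounds
  have hvalid : ∀ i < as.length, ∃ y, M.step x (bitsTrans (as.take i)) = Sum.inl y ∧
      as.getD i false = A.boolIndicator y := by
    intro i
    induction i using Nat.strong_induction_on with
    | _ i IH =>
      intro hi
      have hBz := hall (wB i) (by
        rw [length_wB]
        have := hbound i [] [] (by omega) (by simp) (by simp)
        simp only [List.length_nil] at this; omega)
      rw [mem_matrixL_iff] at hBz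
      have hB : CndB M x as i := by
        have := (hBz.2 (by simp [wB])).1 (by simp [wB])
        simpa [wB] using this
      obtain ⟨y, hy⟩ := hB hi
      have htr : ∀ i' ≤ i, PRelSigma.trans M O x i' = bitsTrans (as.take i') :=
        trans_eq_bitsTrans_take M A x as i (by omega) (fun i' hi' => IH i' hi' (by omega))
      have hsteps : ∀ i' ≤ i, ∃ y', M.step x (PRelSigma.trans M O x i') = Sum.inl y' := by
        intro i' hi'
        rw [htr i' hi']
        rcases Nat.lt_or_ge i' i with h | h
        · obtain ⟨y', hy', -⟩ := IH i' h (by omega)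
          exact ⟨y', hy'⟩
        · obtain rfl : i' = i := le_antisymm hi' h
          exact ⟨y, hy⟩
      have hyq : y ∈ M.queries O (q.eval x.length) x := by
        have h := mem_queries_of_trans M O (q.eval x.length) x i (by omega) hsteps
        rwa [htr i le_rfl, qryOf_eq_of_step_eq hy] at h
      have hylen : y.length ≤ q.eval x.length := (hq x).2 y hyq
      refine ⟨y, hy, ?_⟩
      have hget : (as.drop i).head? = some (as.getD i false) := by
        rw [List.head?_drop, List.getD_eq_getElem?_getD, List.getElem?_eq_getElem hi]
        rfl
      cases hb : as.getD i false with
      | true =>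
        rw [hb] at hget
        -- case `10…`: the certificate puts `y` into `A`
        have hC0 := hall (wC i []) (by
          rw [length_wC]
          have := hbound i [] [] (by omega) (by simp) (by simp)
          simp only [List.length_nil] at this ⊢; omega)
        rw [mem_matrixL_iff] at hC0
        have hC : CndC M E pA pB x as i (elemOf csb i) [] := by
          have := ((hC0.2 (by simp [wC])).2 (by simp [wC])).1 (by simp [wC])
          simpa [wC] using this
        obtain ⟨hlen, -⟩ := hC y hy hi hget
        have hyB : boolPair y (elemOf csb i) ∈ B := by
          rw [hpB]
          intro c' hc'
          have hC1 := hall (wC i c') (by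
            rw [length_wC]
            refine hbound i [] c' (by omega) (by simp) (hc'.trans (TM2Iter.eval_mono pB ?_))
            rw [length_boolPair]
            have := hlen.trans (TM2Iter.eval_mono pA hylen)
            omega)
          rw [mem_matrixL_iff] at hC1
          have hC' : CndC M E pA pB x as i (elemOf csb i) c' := by
            have := ((hC1.2 (by simp [wC])).2 (by simp [wC])).1 (by simp [wC])
            simpa [wC] using this
          exact (hC' y hy hi hget).2 hc'
        exact ((Set.mem_iff_boolIndicator _ _).1 ((hpA y).2 ⟨_, hlen, hyB⟩)).symm
      | false =>
        rw [hb] at hget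
        symm
        rw [← Bool.not_eq_true, ← Set.mem_iff_boolIndicator]
        intro hyA
        obtain ⟨c, hc, hcB⟩ := (hpA y).1 hyA
        have hDz := hall (wD i c) (by
          rw [length_wD]
          have := hbound i c [] (by omega) (hc.trans (TM2Iter.eval_mono pA hylen)) (by simp)
          simp only [List.length_nil] at this; omega)
        rw [mem_matrixL_iff] at hDz
        have hD : CndD M B pA x as i c := by
          have := ((hDz.2 (by simp [wD])).2 (by simp [wD])).2 (by simp [wD])
          simpa [wD] using this
        exact hD y hy hi hget hc hcB
  -- hence the whole run follows the guessed answers and outputs `1`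
  have htr : ∀ i ≤ as.length, PRelSigma.trans M O x i = bitsTrans (as.take i) :=
    trans_eq_bitsTrans_take M A x as as.length le_rfl hvalid
  have hrun : M.run O (q.eval x.length) x = some true := by
    rw [run_eq_some_iff]
    refine ⟨as.length, hA.1, fun i hi => ?_, ?_⟩
    · obtain ⟨y, hy, -⟩ := hvalid i hi
      exact ⟨y, by rw [htr i hi.le]; exact hy⟩
    · rw [htr as.length le_rfl, List.take_length]
      exact hA.2
  have h := (hq x).1
  rw [hrun, Option.some.injEq] at h
  exact (Set.mem_iff_boolIndicator _ _).2 h.symm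

/-- **Completeness of the `∃∀`-form**: the true answer bits with chosen certificates for the `yes`
rounds satisfy the matrix for every `z`, and the certificate is short. [Stockmeyer 1976, proof of Thm. 3.1] [cite: Stockmeyer1976, Thm. 3.1 (proof)] -/
theorem allL_of_mem
    (hpA : ∀ y : List Bool, y ∈ A ↔ ∃ c : List Bool, c.length ≤ pA.eval y.length ∧ boolPair y c ∈ B)
    (hpB : ∀ w : List Bool, w ∈ B ↔ ∀ c' : List Bool, c'.length ≤ pB.eval w.length → boolPair w c' ∈ E)
    {L : Language Bool}
    (hq : ∀ x : List Bool, M.run (Oracle.ofLanguage A) (q.eval x.length) x = some (L.boolIndicator x) ∧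
      ∀ y ∈ M.queries (Oracle.ofLanguage A) (q.eval x.length) x, y.length ≤ q.eval x.length)
    {x : List Bool} (hx : x ∈ L) :
    ∃ (as : List Bool) (cs : List (List Bool)),
      (boolPair as (body cs)).length ≤ (yBd pA q).eval x.length ∧
      ∀ z : List Bool, boolPair (boolPair x (boolPair as (body cs))) z ∈ matrixL M B E pA pB q := by
  classical
  set O := Oracle.ofLanguage A with hO
  have hrun : M.run O (q.eval x.length) x = some true := by
    rw [(hq x).1, (Set.mem_iff_boolIndicator _ _).1 hx]
  obtain ⟨m, hm, hsteps, hfin⟩ := (run_eq_some_iff M O _ x true).1 hrun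
  -- certificates for the `yes` rounds
  have hcert : ∀ y : List Bool, ∃ c : List Bool, (y ∈ A → c.length ≤ pA.eval y.length ∧ boolPair y c ∈ B) ∧
      (y ∉ A → c = []) := by
    intro y
    by_cases hy : y ∈ A
    · obtain ⟨c, hc, hcB⟩ := (hpA y).1 hy
      exact ⟨c, fun _ => ⟨hc, hcB⟩, fun h => absurd hy h⟩
    · exact ⟨[], fun h => absurd h hy, fun _ => rfl⟩
  choose cert hcert using hcert
  set cs := (List.range m).map fun i => cert (qryOf M x (PRelSigma.trans M O x i)) with hcs
  have hcslen : cs.length = m := by simp [hcs]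
  have hcsget : ∀ i < m, cs.getD i [] = cert (qryOf M x (PRelSigma.trans M O x i)) := by
    intro i hi
    rw [List.getD_eq_getElem _ _ (by rw [hcslen]; exact hi)]
    simp [hcs, List.getElem_map, List.getElem_range]
  -- the queries are genuine and short
  have hylen : ∀ i < m, (qryOf M x (PRelSigma.trans M O x i)).length ≤ q.eval x.length := fun i hi =>
    (hq x).2 _ (mem_queries_of_trans M O _ x i (by omega) fun i' hi' => hsteps i' (by omega))
  refine ⟨answerBits M A x m, cs, ?_, fun z => ?_⟩
  · -- length of the certificate
    rw [length_boolPair, yBd_eval, length_answerBits]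
    have hb : ∀ c ∈ cs, c.length ≤ pA.eval (q.eval x.length) := by
      intro c hc
      rw [hcs] at hc
      simp only [List.mem_map, List.mem_range] at hc
      obtain ⟨i, hi, rfl⟩ := hc
      by_cases hyA : qryOf M x (PRelSigma.trans M O x i) ∈ A
      · exact ((hcert _).1 hyA).1.trans (TM2Iter.eval_mono pA (hylen i hi))
      · rw [(hcert _).2 hyA]; simp
    have := length_body_le hb
    rw [hcslen] at this
    have hm' : m * (2 * pA.eval (q.eval x.length) + 2) ≤ q.eval x.length * (2 * pA.eval (q.eval x.length) + 2) :=
      Nat.mul_le_mul_right _ hm.le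
    omega
  · have htr : ∀ i ≤ m, bitsTrans ((answerBits M A x m).take i) = PRelSigma.trans M O x i := fun i hi => by
      rw [answerBits_take M A x hi, ← trans_eq_bitsTrans_answerBits]
    rw [mem_matrixL_iff]
    simp only [boolUnpair_boolPair, elemOf_body]
    refine ⟨fun _ => ⟨by simpa using hm, ?_⟩, fun _ => ⟨fun _ hj => ?_, fun _ => ⟨fun _ => ?_, fun _ => ?_⟩⟩⟩
    · -- last step
      have := htr m le_rfl
      rw [List.take_of_length_le (by simp)] at this
      rw [this]
      exact hfin
    · -- a query round
      rw [length_answerBits] at hj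
      obtain ⟨y, hy⟩ := hsteps _ hj
      exact ⟨y, by rw [htr _ hj.le]; exact hy⟩
    · -- `yes` answers carry certificates
      intro y hy hj hb
      rw [length_answerBits] at hj
      rw [htr _ hj.le] at hy
      have hget := answerBits_getD M A x (i := (boolUnpair (boolUnpair z).2).1.length) hj
      rw [List.head?_drop, List.getElem?_eq_getElem (by simpa using hj)] at hb
      rw [List.getD_eq_getElem?_getD, List.getElem?_eq_getElem (by simpa using hj)] at hget
      simp only [Option.some.injEq, Option.getD_some] at hb hget
      rw [hb, qryOf_eq_of_step_eq hy] at hget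
      have hyA : y ∈ A := (Set.mem_iff_boolIndicator _ _).2 hget.symm
      rw [hcsget _ hj, qryOf_eq_of_step_eq hy]
      obtain ⟨hc, hcB⟩ := (hcert y).1 hyA
      exact ⟨hc, fun hc' => (hpB _).1 hcB _ hc'⟩
    · -- `no` answers have no certificate
      intro y hy hj hb hc hcB
      rw [length_answerBits] at hj
      rw [htr _ hj.le] at hy
      have hget := answerBits_getD M A x (i := (boolUnpair (boolUnpair z).2).1.length) hj
      rw [List.head?_drop, List.getElem?_eq_getElem (by simpa using hj)] at hb
      rw [List.getD_eq_getElem?_getD, List.getElem?_eq_getElem (by simpa using hj)] at hget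
      simp only [Option.some.injEq, Option.getD_some] at hb hget
      rw [hb, qryOf_eq_of_step_eq hy] at hget
      have hyA : y ∉ A := fun h => by
        have := (Set.mem_iff_boolIndicator _ _).1 h
        rw [← hget] at this
        exact Bool.false_ne_true this
      exact hyA ((hpA y).2 ⟨_, hc, hcB⟩)

/-- **The `∃∀`-form of `L ∈ P^A`** with certificates. [Stockmeyer 1976, proof of Thm. 3.1] [cite: Stockmeyer1976, Thm. 3.1 (proof)] -/
theorem mem_iff_exists_allL
    (hpA : ∀ y : List Bool, y ∈ A ↔ ∃ c : List Bool, c.length ≤ pA.eval y.length ∧ boolPair y c ∈ B)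
    (hpB : ∀ w : List Bool, w ∈ B ↔ ∀ c' : List Bool, c'.length ≤ pB.eval w.length → boolPair w c' ∈ E)
    {L : Language Bool}
    (hq : ∀ x : List Bool, M.run (Oracle.ofLanguage A) (q.eval x.length) x = some (L.boolIndicator x) ∧
      ∀ y ∈ M.queries (Oracle.ofLanguage A) (q.eval x.length) x, y.length ≤ q.eval x.length)
    (x : List Bool) :
    x ∈ L ↔ ∃ Y : List Bool, Y.length ≤ (yBd pA q).eval x.length ∧
      boolPair x Y ∈ allL M B E pA pB q (zBd pA pB q) := by
  constructor
  · intro hx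
    obtain ⟨as, cs, hlen, hall⟩ := allL_of_mem hpA hpB hq hx
    exact ⟨_, hlen, fun z _ => hall z⟩
  · rintro ⟨Y, -, hall⟩
    exact mem_of_allL hpA hpB hq hall

end Correctness

end PRelSigPi

/-- **`A ∈ Σₖ₊₁ᵖ ⇒ P^A ⊆ Σₖ₊₂ᵖ`**, i.e. `P^{Σₖ₊₁} ⊆ Σₖ₊₂` one level up (guess answers and
certificates; `Σₖ₊₂ = ∃ᵖ·Πₖ₊₁`, `Πₖ₊₁ = ∀ᵖ·Σₖ`). (Stockmeyer 1976, Thm. 3.1 with §3.) [cite: Stockmeyer1976, Thm. 3.1] -/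
theorem PRel_ofLanguage_subset_SigmaP_succ {k : ℕ} {A : Language Bool} (hA : A ∈ SigmaP (k + 1)) :
    PRel (Oracle.ofLanguage A) ⊆ SigmaP (k + 2) := by
  intro L hL
  obtain ⟨M, hM, q, hq⟩ := hL
  obtain ⟨B, hB, pA, hpA⟩ := hA
  have hBc : Bᶜ ∈ SigmaP k := hB
  obtain ⟨E, hE, pB, hpB⟩ := exists_forall_rep_of_mem_PiP (show B ∈ PiP k from hB)
  refine ⟨PRelSigPi.allL M B E pA pB q (PRelSigPi.zBd pA pB q), ?_, PRelSigPi.yBd pA q, fun x =>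
    PRelSigPi.mem_iff_exists_allL hpA hpB hq x⟩
  exact PRelSigPi.allL_mem_polyForall M B E pA pB q (PRelSigPi.matrixL_mem_SigmaP M B E pA pB q hM hE hBc) _

/-- **`Δₖ₊₁ᵖ ⊆ Σₖ₊₁ᵖ ∩ Πₖ₊₁ᵖ` for every `k`** (Stockmeyer's inclusion diagram: `Δ₁ = P`, and for
`k ≥ 1` the theorem above together with closure of `P^A` under complement).
(Stockmeyer 1976, §3 with Thm. 3.1.) [cite: Stockmeyer1976, §3 (inclusion structure) with Thm. 3.1] -/
theorem stockmeyer_DeltaP_succ_subset (k : ℕ) : DeltaP (k + 1) ⊆ SigmaP (k + 1) ∩ PiP (k + 1) := by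
  cases k with
  | zero =>
    intro L hL
    have hP : L ∈ Classes.P := by rw [← DeltaP_one_eq_P]; exact hL
    exact ⟨P_subset_SigmaP 1 hP, show Lᶜ ∈ SigmaP 1 from P_subset_SigmaP 1 (compl_mem_P_iff.2 hP)⟩
  | succ k =>
    intro L hL
    obtain ⟨A, hA, hLA⟩ := mem_PRelClass_iff.1 hL
    exact ⟨PRel_ofLanguage_subset_SigmaP_succ hA hLA, PRel_ofLanguage_subset_SigmaP_succ hA (compl_mem_PRel hLA)⟩

end Literature.Computability.Complexity
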